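import Summits.QuantumFields.BalabanUV.Beta.EriceRemainderEnclosureHistoryAutonomyComparisonDualContractionClosed

/-!
# EriceRemainderEnclosureHistoryAutonomyComparisonDefect — (E140a) **SIGN-FREE EXCESSES: THE DEFECT LAW `θ·(1+τ) ≤ 1`.**  (E138)'s contraction class WITHOUT the
# sign of the excess: `B` isotone on the box `]0,γ]^ℕ` (floor `b > 0`, zeroth moment `M`) and LEVEL-LIPSCHITZ IN ITS HISTORY with age profile `Λ ≥ 0` on the graded
# box, age moment `θ := Σ_{k<K} k·Λ_k`; `B′` ANY functional with `B ≤ B′ ≤ β̄` whose excess `D := B′ − B` has ISOTONICITY DEFECT `τ ≥ 0`: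
# `u ≤ v ⟹ D u ≤ (1+τ)·D v` (`τ = 0`: isotone excess, (E138); `τ = ∞`: an excess vanishing at some configuration and positive below it — (E49b)'s
# UV-activated switch, which breaks comparison for EVERY memory strength).  THEN **`θ·(1+τ) ≤ 1 ⟹ h′ ≤ h` at every scale** for ANY box solutions `h, h′` of
# `B, B′` from one pin (`le_of_excess_defect`).  COROLLARY (`le_of_two_sided_excess`): an excess with NO sign structure at all but TWO-SIDED bounds
# `ε_lo ≤ B′ − B ≤ ε_hi` on the box (`ε_lo > 0`) compares as soon as **`θ·ε_hi ≤ ε_lo`**.  EXACT: (E140b) `…ComparisonDefectSharp` — on (E49b)'s one-age hinge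
# `1 + M·max(4 − 1∕u₁², 0)` (`θ = M`) with the two-level excess `ε·(1 + τ·switch(1∕u₀²))` (defect exactly `τ`) comparison FAILS iff `M·(1+τ) > 1`.

Cell `pub-balaban`, β-function sub-cell, BINDER row D4 «RemainderConst leaves for Bałaban's split» (`HOME/BINDER-OWNERS.md`; owner lineage `b2b-balaban-beta-an4`;
this file by co-owner #2 lineage `b2b-balaban-beta-d4-p2`, generation 108), β-FLOW TEAM duty (1), FREEZE (0) honoured (def-free; (E138b) `flow_link_lower` ∕
`flow_link_upper` ∕ `flow_violation_bound`, (E138a) `dual_step_eq_levels`, (E138e) `le_of_isotone_excess_moment_le_one`, (E132) `cmp_of_dual_steps_nonneg`, (E48a)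
`strictAnti_of_memFlow`, (E39) `exists_memFlow_zm`, (E43b) `memFlow_unique_of_monotone_zm` BY NAME; nothing restated).  Successor item (β) of
`HOME/b2b-balaban-beta-d4-p2/g107/README.md` §4 («non-isotone excesses (need a sign)»): the sign is replaced by a NUMBER, the defect `τ`, and the law is `θ(1+τ) ≤ 1`.

HONEST FRAMING (page 1, verbatim and binding).  *"Discharging BetaPertH makes Bałaban's UV stability UNCONDITIONAL — a real constructive-QFT result; it is
NOT the continuum limit and NOT the Clay problem."*  THIS FILE DISCHARGES NOTHING OF THE KIND.  Elementary real analysis about ABSTRACT functionals on a box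
]0,γ]^ℕ (node U2's `MemFlow` ∕ `SeqBox`) — hypotheses of a census, not facts: whether Bałaban's (1.22) limit functional is isotone, level-Lipschitz in its history,
has age moment below one, or whether a two-loop ∕ remainder perturbation of it has two-sided bounds of a given ratio is NOT PRINTED ([I] p. 298; GAPS G-t4-U2-1∕-2) and
NOT asserted.  Row D4 class UNCHANGED (critical-path width 0; instance 0∕1; D4 DISCHARGE NO DATE).  NOT B12 Thm 2, NOT BetaPertH, NOT continuum YM, NOT Clay.

THE IDEA ((E138)'s contraction with a quasi-monotone source).  One perturbed orbit `h′`, the base family `S` restarted at its points, dual steps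
`X_n = 1∕h′_{n+1}² − 1∕(S h′_n)_1²`, source `E_n = D(tail_{n+1}h′) ≥ 0`.  The links `E_n − X_n ≤ Σ_k Λ_k Σ_{l≤k} X⁺_{n+l}`, `X_n − E_n ≤ Σ_k Λ_k Σ_{l≤k} X⁻_{n+l}` and the
initial bound `β̄` are (E138b)'s, sign-free.  The ONLY place (E138) reads the sign of the excess is the source comparison `E_{n+l} ≤ E_n` inside the link: a negative step
`X_n = −ν` is paid by later positive parts `X⁺_{n+l} ≤ E_{n+l} + C`.  With defect `τ` the tails of the decreasing orbit give `E_{n+l} ≤ (1+τ)·E_n` instead, so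
`E_n + ν ≤ θ((1+τ)E_n + C)`, i.e. `ν ≤ θC − (1 − θ(1+τ))·E_n ≤ θC` as soon as `θ(1+τ) ≤ 1`; overshoots contract by `θ` as before.  Hence the violations contract by
`θ < 1` (automatic when `τ > 0`; at `τ = 0` the closed case is (E138e)), `0 ≤ X_n ≤ E_n`, and `X ≥ 0` is comparison ((E132)).

WHAT IS PROVED ([folklore]; 0 `def`, 0 sorry).  §1 (sequences) **`link_contract_defect`**, **`sandwich_of_links_defect`**.  §2 (flow) `flow_source_le_defect`,
**`dual_steps_sandwich_defect`**.  §3 **`le_of_excess_defect_lt`** (strict moment), **`le_of_excess_defect`** (closed law `θ(1+τ) ≤ 1`), **`le_of_two_sided_excess`**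
(`ε_lo ≤ B′ − B ≤ ε_hi`, `θ·ε_hi ≤ ε_lo`).
-/

noncomputable section
open Finset Set

namespace Summit.QuantumFields.BalabanUV.Beta.EriceRemainderEnclosureHistoryAutonomyComparisonDefect

open Literature.MathematicalPhysics.QuantumFieldTheory.Balaban1983to89
open Literature.MathematicalPhysics.QuantumFieldTheory.Balaban1983to89.T4BetaStationary
open Literature.MathematicalPhysics.QuantumFieldTheory.Balaban1983to89.T4BetaFlowWellPosed
open Summit.QuantumFields.BalabanUV.Beta.EriceRemainderEnclosureHistoryAutonomyOrder (strictAnti_of_memFlow)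
open Summit.QuantumFields.BalabanUV.Beta.EriceRemainderEnclosureHistoryAutonomyComparisonDualOrbit (cmp_of_dual_steps_nonneg)
open Summit.QuantumFields.BalabanUV.Beta.EriceRemainderEnclosureHistoryAutonomyComparisonDualContractionLinks (dual_step_eq_levels)
open Summit.QuantumFields.BalabanUV.Beta.EriceRemainderEnclosureHistoryAutonomyComparisonDualContraction
  (flow_link_lower flow_link_upper flow_violation_bound)
open Summit.QuantumFields.BalabanUV.Beta.EriceRemainderEnclosureHistoryAutonomyComparisonDualContractionClosed (le_of_isotone_excess_moment_le_one)

/-! ## §1 The contraction on sequences with a QUASI-MONOTONE source -/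

/-- **ONE LINK OF THE CONTRACTION, QUASI-MONOTONE SOURCE.**  Sequences `X` (dual steps), `E ≥ 0` (sources) with DEFECT `τ ≥ 0`: `E_{n+l+1} ≤ (1+τ)·E_n`; a profile
`Λ ≥ 0` on `range K` with age moment `θ = Σ_k k·Λ_k` and **`(1+τ)·θ ≤ 1`**; the two LINK INEQUALITIES `E_n − X_n ≤ Σ_k Λ_k Σ_{l≤k} X⁺_{n+l}`,
`X_n − E_n ≤ Σ_k Λ_k Σ_{l≤k} X⁻_{n+l}`.  If the violations `X⁻_m` and `X_m − E_m` are `≤ C` everywhere, they are `≤ θ·C` everywhere: a negative step `−ν` is paid by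
later positive parts `≤ (1+τ)E_n + C`, so `ν ≤ θC − (1 − θ(1+τ))E_n ≤ θC`; an overshoot is paid by later negative parts.  (`τ = 0`: (E138a) `link_contract`.) [folklore] -/
theorem link_contract_defect {X E Λ : ℕ → ℝ} {K : ℕ} {C τ : ℝ}
    (hΛ : ∀ k, 0 ≤ Λ k) (hτ : 0 ≤ τ) (hθτ : (1 + τ) * ∑ k ∈ range K, (k : ℝ) * Λ k ≤ 1)
    (hE0 : ∀ n, 0 ≤ E n) (hEdef : ∀ n l, E (n + (l + 1)) ≤ (1 + τ) * E n)
    (hLm : ∀ n, E n - X n ≤ ∑ k ∈ range K, Λ k * ∑ l ∈ range (k + 1), max (X (n + l)) 0)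
    (hLp : ∀ n, X n - E n ≤ ∑ k ∈ range K, Λ k * ∑ l ∈ range (k + 1), max (-X (n + l)) 0)
    (hC : ∀ m, max (-X m) 0 ≤ C ∧ X m - E m ≤ C) (n : ℕ) :
    max (-X n) 0 ≤ (∑ k ∈ range K, (k : ℝ) * Λ k) * C ∧ X n - E n ≤ (∑ k ∈ range K, (k : ℝ) * Λ k) * C := by
  set θ : ℝ := ∑ k ∈ range K, (k : ℝ) * Λ k with hθ
  have hC0 : 0 ≤ C := (le_max_right _ _).trans (hC 0).1
  have hθ0 : 0 ≤ θ := sum_nonneg fun k _ => mul_nonneg (Nat.cast_nonneg k) (hΛ k)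
  have hθC : 0 ≤ θ * C := mul_nonneg hθ0 hC0
  -- the later positive parts in a window: each at most (1+τ)·E n + C
  have hpos : ∀ l, max (X (n + (l + 1))) 0 ≤ (1 + τ) * E n + C := fun l =>
    max_le (by linarith [(hC (n + (l + 1))).2, hEdef n l])
      (by nlinarith [hE0 n])
  have hneg : ∀ l, max (-X (n + (l + 1))) 0 ≤ C := fun l => (hC (n + (l + 1))).1
  -- split off the l = 0 term of each window sum
  have hwinP : ∀ k ∈ range K, Λ k * ∑ l ∈ range (k + 1), max (X (n + l)) 0
      ≤ Λ k * max (X n) 0 + ((k : ℝ) * Λ k) * ((1 + τ) * E n + C) := by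
    intro k _
    rw [sum_range_succ', Nat.add_zero]
    have hs : ∑ l ∈ range k, max (X (n + (l + 1))) 0 ≤ ∑ l ∈ range k, ((1 + τ) * E n + C) := sum_le_sum fun l _ => hpos l
    rw [sum_const, card_range, nsmul_eq_mul] at hs
    nlinarith [hΛ k, hs]
  have hwinN : ∀ k ∈ range K, Λ k * ∑ l ∈ range (k + 1), max (-X (n + l)) 0 ≤ Λ k * max (-X n) 0 + ((k : ℝ) * Λ k) * C := by
    intro k _
    rw [sum_range_succ', Nat.add_zero]
    have hs : ∑ l ∈ range k, max (-X (n + (l + 1))) 0 ≤ ∑ l ∈ range k, C := sum_le_sum fun l _ => hneg l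
    rw [sum_const, card_range, nsmul_eq_mul] at hs
    nlinarith [hΛ k, hs]
  have hLm' : E n - X n ≤ (∑ k ∈ range K, Λ k) * max (X n) 0 + θ * ((1 + τ) * E n + C) := by
    refine (hLm n).trans ((sum_le_sum hwinP).trans_eq ?_)
    rw [sum_add_distrib, sum_mul, sum_mul]
  have hLp' : X n - E n ≤ (∑ k ∈ range K, Λ k) * max (-X n) 0 + θ * C := by
    refine (hLp n).trans ((sum_le_sum hwinN).trans_eq ?_)
    rw [sum_add_distrib, sum_mul, sum_mul]
  -- the quasi-monotone source: (1+τ)θ·E n ≤ E n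
  have hsrc : (1 + τ) * θ * E n ≤ 1 * E n := mul_le_mul_of_nonneg_right hθτ (hE0 n)
  constructor
  · by_cases hX : 0 ≤ X n
    · rw [max_eq_right (by linarith)]; exact hθC
    · have hX' : X n < 0 := lt_of_not_ge hX
      rw [max_eq_left (by linarith)]
      rw [max_eq_right hX'.le, mul_zero, zero_add] at hLm'
      nlinarith [hE0 n, hsrc]
  · by_cases hXE : X n ≤ E n
    · linarith
    · have hXE' : E n < X n := lt_of_not_ge hXE
      have hX0 : 0 ≤ X n := (hE0 n).trans hXE'.le
      rw [max_eq_right (by linarith), mul_zero, zero_add] at hLp'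
      exact hLp'

/-- **THE CONTRACTION, QUASI-MONOTONE SOURCE.**  Under the hypotheses of `link_contract_defect` with, in addition, STRICT age moment `θ < 1` (automatic when `τ > 0`) and an
initial bound `C₀` on the violations, all violations vanish: `0 ≤ X_n ≤ E_n` at every `n` (iterate the link: `≤ θ^j·C₀ → 0`). [folklore] -/
theorem sandwich_of_links_defect {X E Λ : ℕ → ℝ} {K : ℕ} {C₀ τ : ℝ}
    (hΛ : ∀ k, 0 ≤ Λ k) (hθ : ∑ k ∈ range K, (k : ℝ) * Λ k < 1)
    (hτ : 0 ≤ τ) (hθτ : (1 + τ) * ∑ k ∈ range K, (k : ℝ) * Λ k ≤ 1)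
    (hE0 : ∀ n, 0 ≤ E n) (hEdef : ∀ n l, E (n + (l + 1)) ≤ (1 + τ) * E n)
    (hLm : ∀ n, E n - X n ≤ ∑ k ∈ range K, Λ k * ∑ l ∈ range (k + 1), max (X (n + l)) 0)
    (hLp : ∀ n, X n - E n ≤ ∑ k ∈ range K, Λ k * ∑ l ∈ range (k + 1), max (-X (n + l)) 0)
    (hC : ∀ m, max (-X m) 0 ≤ C₀ ∧ X m - E m ≤ C₀) (n : ℕ) :
    0 ≤ X n ∧ X n ≤ E n := by
  set θ : ℝ := ∑ k ∈ range K, (k : ℝ) * Λ k with hθdef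
  have hC0 : 0 ≤ C₀ := (le_max_right _ _).trans (hC 0).1
  have hθ0 : 0 ≤ θ := sum_nonneg fun k _ => mul_nonneg (Nat.cast_nonneg k) (hΛ k)
  have iter : ∀ j : ℕ, ∀ m, max (-X m) 0 ≤ θ ^ j * C₀ ∧ X m - E m ≤ θ ^ j * C₀ := by
    intro j
    induction j with
    | zero => simpa using hC
    | succ j ih =>
      intro m
      have h := link_contract_defect hΛ hτ hθτ hE0 hEdef hLm hLp ih m
      rw [pow_succ, mul_comm (θ ^ j) θ, mul_assoc]
      exact h
  have hsmall : ∀ ε : ℝ, 0 < ε → ∃ j : ℕ, θ ^ j * C₀ < ε := by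
    intro ε hε
    obtain ⟨j, hj⟩ := exists_pow_lt_of_lt_one (div_pos hε (by linarith : (0 : ℝ) < C₀ + 1)) hθ
    refine ⟨j, ?_⟩
    have h1 : θ ^ j * C₀ ≤ θ ^ j * (C₀ + 1) := mul_le_mul_of_nonneg_left (by linarith) (pow_nonneg hθ0 j)
    have h2 : θ ^ j * (C₀ + 1) < ε := by
      have := (lt_div_iff₀ (by linarith : (0 : ℝ) < C₀ + 1)).mp hj
      linarith
    linarith
  constructor
  · by_contra hX
    have hX' : X n < 0 := lt_of_not_ge hX
    obtain ⟨j, hj⟩ := hsmall (-X n) (by linarith)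
    have := (iter j n).1
    rw [max_eq_left (by linarith)] at this
    linarith
  · by_contra hX
    have hX' : E n < X n := lt_of_not_ge hX
    obtain ⟨j, hj⟩ := hsmall (X n - E n) (by linarith)
    linarith [(iter j n).2]

/-! ## §2 The flow: the source along one orbit has the defect of the excess; the dual steps are sandwiched -/

variable {B B' : (ℕ → ℝ) → ℝ} {M γ b : ℝ} {S : ℝ → ℕ → ℝ} {h h' : ℕ → ℝ}

/-- THE SOURCE ALONG ONE ORBIT HAS THE DEFECT OF THE EXCESS: if `u ≤ v ⟹ (B′−B) u ≤ (1+τ)·(B′−B) v` on the box and `h′` is a box solution of `B′` (strictly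
decreasing since `B′ ≥ b′ > 0`), then `E_{n+l+1} ≤ (1+τ)·E_n` for `E_n = (B′−B)(tail_{n+1}h′)` — deeper tails lie below shallower ones. [folklore] -/
theorem flow_source_le_defect {b' τ : ℝ} (hb' : 0 < b') (hlo' : ∀ u, SeqBox γ u → b' ≤ B' u)
    (hDdef : ∀ u v : ℕ → ℝ, SeqBox γ u → SeqBox γ v → (∀ i, u i ≤ v i) → B' u - B u ≤ (1 + τ) * (B' v - B v))
    (hh' : SeqBox γ h') {y : ℝ} (hf' : MemFlow B' y h') (n l : ℕ) :
    B' (fun i => h' (n + (l + 1) + 1 + i)) - B (fun i => h' (n + (l + 1) + 1 + i))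
      ≤ (1 + τ) * (B' (fun i => h' (n + 1 + i)) - B (fun i => h' (n + 1 + i))) := by
  have hanti := (strictAnti_of_memFlow hb' hlo' hh' hf').antitone
  exact hDdef _ _ (fun i => hh' _) (fun i => hh' _) fun i => hanti (by omega)

/-- **THE DUAL STEPS ARE SANDWICHED, SIGN-FREE EXCESS: `0 ≤ X_n ≤ E_n` AT EVERY DEPTH.**  Base `B`: isotone, floor `b > 0`, modulus `M`, unique box solutions `S q`,
LEVEL-LIPSCHITZ AGE PROFILE `Λ ≥ 0` on the graded box with age moment `θ = Σ_{k<K} k·Λ_k < 1`.  Perturbed `B′`: `B ≤ B′ ≤ β̄` on the box, excess with DEFECT `τ ≥ 0`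
(`u ≤ v ⟹ (B′−B)u ≤ (1+τ)(B′−B)v`) and **`(1+τ)·θ ≤ 1`**; `h′` a box solution of `B′` from a pin in `]0,γ]`.  Then `0 ≤ X_n ≤ (B′−B)(tail_{n+1}h′)` for the dual steps
`X_n = 1∕h′_{n+1}² − 1∕(S h′_n)_1²` — `sandwich_of_links_defect` fed with (E138b)'s sign-free links and initial bound and §2's source. [folklore] -/
theorem dual_steps_sandwich_defect {Λ : ℕ → ℝ} {K : ℕ} {βb τ : ℝ} (hb : 0 < b)
    (hmono : ∀ u v : ℕ → ℝ, SeqBox γ u → SeqBox γ v → (∀ i, u i ≤ v i) → B u ≤ B v)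
    (hB : ∀ u u' : ℕ → ℝ, SeqBox γ u → SeqBox γ u' → ∀ D : ℝ, (∀ j, |u j - u' j| ≤ D) → |B u - B u'| ≤ M * D) (hM : 0 ≤ M)
    (hlo : ∀ u, SeqBox γ u → b ≤ B u)
    (hS : ∀ p, 0 < p → p ≤ γ → SeqBox γ (S p) ∧ MemFlow B p (S p))
    (huniq : ∀ p, 0 < p → p ≤ γ → ∀ u u' : ℕ → ℝ, SeqBox γ u → SeqBox γ u' → MemFlow B p u → MemFlow B p u' → u = u')
    (hΛ : ∀ k, 0 ≤ Λ k) (hθ : ∑ k ∈ range K, (k : ℝ) * Λ k < 1)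
    (hτ : 0 ≤ τ) (hθτ : (1 + τ) * ∑ k ∈ range K, (k : ℝ) * Λ k ≤ 1)
    (hLip : ∀ u v : ℕ → ℝ, SeqBox γ u → SeqBox γ v → (∀ k : ℕ, 1 / γ ^ 2 + ((k : ℝ) + 1) * b ≤ 1 / u k ^ 2) →
      (∀ k : ℕ, 1 / γ ^ 2 + ((k : ℝ) + 1) * b ≤ 1 / v k ^ 2) → B u - B v ≤ ∑ k ∈ range K, Λ k * max (1 / v k ^ 2 - 1 / u k ^ 2) 0)
    (hexc : ∀ u, SeqBox γ u → B u ≤ B' u) (hbdd : ∀ u, SeqBox γ u → B' u ≤ βb)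
    (hDdef : ∀ u v : ℕ → ℝ, SeqBox γ u → SeqBox γ v → (∀ i, u i ≤ v i) → B' u - B u ≤ (1 + τ) * (B' v - B v))
    (hh' : SeqBox γ h') {y : ℝ} (hy : 0 < y) (hyγ : y ≤ γ) (hf' : MemFlow B' y h') (n : ℕ) :
    0 ≤ 1 / h' (n + 1) ^ 2 - 1 / S (h' n) 1 ^ 2
      ∧ 1 / h' (n + 1) ^ 2 - 1 / S (h' n) 1 ^ 2 ≤ B' (fun i => h' (n + 1 + i)) - B (fun i => h' (n + 1 + i)) := by
  have hlo' : ∀ u, SeqBox γ u → b ≤ B' u := fun u hu => (hlo u hu).trans (hexc u hu)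
  exact sandwich_of_links_defect (X := fun m => 1 / h' (m + 1) ^ 2 - 1 / S (h' m) 1 ^ 2)
    (E := fun m => B' (fun i => h' (m + 1 + i)) - B (fun i => h' (m + 1 + i))) hΛ hθ hτ hθτ
    (fun m => sub_nonneg.mpr (hexc _ fun i => hh' (m + 1 + i)))
    (fun m l => flow_source_le_defect hb hlo' hDdef hh' hf' m l)
    (fun m => flow_link_lower hb hmono hB hM hlo hS huniq hΛ hLip hexc hh' hy hyγ hf' m)
    (fun m => flow_link_upper hb hmono hB hM hlo hS huniq hΛ hLip hexc hh' hy hyγ hf' m)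
    (fun m => flow_violation_bound hb hlo hS hexc hbdd hh' hf' m) n

/-! ## §3 The comparison theorems: strict moment, the closed defect law, two-sided excesses -/

/-- **COMPARISON FOR A SIGN-FREE EXCESS OF DEFECT `τ`, STRICT MOMENT.**  `B`: isotone on `]0,γ]^ℕ`, zeroth moment `M`, floor `b > 0`, level-Lipschitz age profile `Λ ≥ 0` on the
graded box with `θ = Σ_{k<K} k·Λ_k < 1`; `B′`: ANY functional with `B ≤ B′ ≤ β̄` and excess of defect `τ ≥ 0` with `(1+τ)θ ≤ 1`; `h, h′` ANY box solutions of `B, B′` from one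
pin.  Then `h′ ≤ h` at every scale.  Proof: (E39)∕(E43b) base family, `dual_steps_sandwich_defect`, (E132) `cmp_of_dual_steps_nonneg`. [folklore] -/
theorem le_of_excess_defect_lt {Λ : ℕ → ℝ} {K : ℕ} {βb p τ : ℝ}
    (hmono : ∀ u v : ℕ → ℝ, SeqBox γ u → SeqBox γ v → (∀ i, u i ≤ v i) → B u ≤ B v)
    (hB : ∀ u u' : ℕ → ℝ, SeqBox γ u → SeqBox γ u' → ∀ D : ℝ, (∀ j, |u j - u' j| ≤ D) → |B u - B u'| ≤ M * D) (hM : 0 ≤ M)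
    (hb : 0 < b) (hlo : ∀ u, SeqBox γ u → b ≤ B u)
    (hΛ : ∀ k, 0 ≤ Λ k) (hθ : ∑ k ∈ range K, (k : ℝ) * Λ k < 1)
    (hτ : 0 ≤ τ) (hθτ : (1 + τ) * ∑ k ∈ range K, (k : ℝ) * Λ k ≤ 1)
    (hLip : ∀ u v : ℕ → ℝ, SeqBox γ u → SeqBox γ v → (∀ k : ℕ, 1 / γ ^ 2 + ((k : ℝ) + 1) * b ≤ 1 / u k ^ 2) →
      (∀ k : ℕ, 1 / γ ^ 2 + ((k : ℝ) + 1) * b ≤ 1 / v k ^ 2) → B u - B v ≤ ∑ k ∈ range K, Λ k * max (1 / v k ^ 2 - 1 / u k ^ 2) 0)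
    (hexc : ∀ u, SeqBox γ u → B u ≤ B' u) (hbdd : ∀ u, SeqBox γ u → B' u ≤ βb)
    (hDdef : ∀ u v : ℕ → ℝ, SeqBox γ u → SeqBox γ v → (∀ i, u i ≤ v i) → B' u - B u ≤ (1 + τ) * (B' v - B v))
    (hp : 0 < p) (hpγ : p ≤ γ) (hh : SeqBox γ h) (hf : MemFlow B p h) (hh' : SeqBox γ h') (hf' : MemFlow B' p h') (j : ℕ) :
    h' j ≤ h j := by
  -- the unique base family
  have hex : ∀ q : ℝ, 0 < q → q ≤ γ → ∃ k : ℕ → ℝ, SeqBox γ k ∧ MemFlow B q k :=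
    fun q hq hqγ => Summit.QuantumFields.BalabanUV.Beta.EriceRemainderEnclosureHistoryAutonomyExistence.exists_memFlow_zm hB hM hq hqγ hb hlo
  choose! S hSb hSf using hex
  have hS : ∀ q, 0 < q → q ≤ γ → SeqBox γ (S q) ∧ MemFlow B q (S q) := fun q hq hqγ => ⟨hSb q hq hqγ, hSf q hq hqγ⟩
  have huniq : ∀ q, 0 < q → q ≤ γ → ∀ u u' : ℕ → ℝ, SeqBox γ u → SeqBox γ u' → MemFlow B q u → MemFlow B q u' → u = u' :=
    fun q hq _ u u' hu hu' hfu hfu' =>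
      Summit.QuantumFields.BalabanUV.Beta.EriceRemainderEnclosureHistoryAutonomyMonotoneGeneral.memFlow_unique_of_monotone_zm
        hmono hB hM hq hb hlo hu hu' hfu hfu'
  have e : h = S p := huniq p hp hpγ _ _ hh (hS p hp hpγ).1 hf (hS p hp hpγ).2
  rw [e]
  refine cmp_of_dual_steps_nonneg (B' := B') hb hB hM hlo hS huniq hp hpγ hh' hf' j (fun i _ => ?_) j le_rfl
  have h0 := (dual_steps_sandwich_defect hb hmono hB hM hlo hS huniq hΛ hθ hτ hθτ hLip hexc hbdd hDdef hh' hp hpγ hf' i).1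
  have heq := dual_step_eq_levels hS hh' hf' i
  linarith

/-- **THE DEFECT LAW (closed form): `θ·(1+τ) ≤ 1 ⟹ COMPARISON`, for EVERY excess of isotonicity defect `τ ≥ 0` over EVERY isotone memory with level-Lipschitz age moment
`θ`.**  `B`: isotone on the box `]0,γ]^ℕ` with a zeroth moment `M` and floor `b > 0`, LEVEL-LIPSCHITZ IN ITS HISTORY with age profile `Λ ≥ 0`:
`B u − B v ≤ Σ_{k<K} Λ_k·(1∕v_k² − 1∕u_k²)⁺` for box configurations whose age-`k` levels are `≥ 1∕γ² + (k+1)·b`; `θ := Σ_{k<K} k·Λ_k`.  `B′`: ANY functional with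
`B ≤ B′ ≤ β̄` on the box whose excess `D = B′ − B` satisfies `u ≤ v ⟹ D u ≤ (1+τ)·D v` (no modulus, no steepness, no size, NO SIGN beyond the defect).  `h, h′`: ANY box
solutions of `B, B′` from one pin `p`.  If **`(1+τ)·θ ≤ 1`** then **`h′ ≤ h` at every scale.**  `τ = 0` is (E138e) (`θ ≤ 1`); `τ > 0` forces `θ < 1` and is
`le_of_excess_defect_lt`.  EXACT: (E140b) — on (E49b)'s one-age hinge with the two-level switch excess of defect `τ`, comparison fails iff `θ(1+τ) > 1`. [folklore] -/
theorem le_of_excess_defect {Λ : ℕ → ℝ} {K : ℕ} {βb p τ : ℝ}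
    (hmono : ∀ u v : ℕ → ℝ, SeqBox γ u → SeqBox γ v → (∀ i, u i ≤ v i) → B u ≤ B v)
    (hB : ∀ u u' : ℕ → ℝ, SeqBox γ u → SeqBox γ u' → ∀ D : ℝ, (∀ j, |u j - u' j| ≤ D) → |B u - B u'| ≤ M * D) (hM : 0 ≤ M)
    (hb : 0 < b) (hlo : ∀ u, SeqBox γ u → b ≤ B u)
    (hΛ : ∀ k, 0 ≤ Λ k) (hτ : 0 ≤ τ) (hθτ : (1 + τ) * ∑ k ∈ range K, (k : ℝ) * Λ k ≤ 1)
    (hLip : ∀ u v : ℕ → ℝ, SeqBox γ u → SeqBox γ v → (∀ k : ℕ, 1 / γ ^ 2 + ((k : ℝ) + 1) * b ≤ 1 / u k ^ 2) →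
      (∀ k : ℕ, 1 / γ ^ 2 + ((k : ℝ) + 1) * b ≤ 1 / v k ^ 2) → B u - B v ≤ ∑ k ∈ range K, Λ k * max (1 / v k ^ 2 - 1 / u k ^ 2) 0)
    (hexc : ∀ u, SeqBox γ u → B u ≤ B' u) (hbdd : ∀ u, SeqBox γ u → B' u ≤ βb)
    (hDdef : ∀ u v : ℕ → ℝ, SeqBox γ u → SeqBox γ v → (∀ i, u i ≤ v i) → B' u - B u ≤ (1 + τ) * (B' v - B v))
    (hp : 0 < p) (hpγ : p ≤ γ) (hh : SeqBox γ h) (hf : MemFlow B p h) (hh' : SeqBox γ h') (hf' : MemFlow B' p h') (j : ℕ) :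
    h' j ≤ h j := by
  have hθ0 : 0 ≤ ∑ k ∈ range K, (k : ℝ) * Λ k := sum_nonneg fun k _ => mul_nonneg (Nat.cast_nonneg k) (hΛ k)
  rcases hτ.eq_or_lt with hτ0 | hτpos
  · -- τ = 0: the excess is isotone and θ ≤ 1 — (E138e)
    subst hτ0
    have hθ1 : ∑ k ∈ range K, (k : ℝ) * Λ k ≤ 1 := by linarith
    have hDmono : ∀ u v : ℕ → ℝ, SeqBox γ u → SeqBox γ v → (∀ i, u i ≤ v i) → B' u - B u ≤ B' v - B v := by
      intro u v hu hv huv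
      have := hDdef u v hu hv huv
      linarith
    exact le_of_isotone_excess_moment_le_one hmono hB hM hb hlo hΛ hθ1 hLip hexc hbdd hDmono hp hpγ hh hf hh' hf' j
  · -- τ > 0: θ ≤ 1∕(1+τ) < 1
    have hθ : ∑ k ∈ range K, (k : ℝ) * Λ k < 1 := by
      by_contra hge
      have hge' : 1 ≤ ∑ k ∈ range K, (k : ℝ) * Λ k := le_of_not_gt hge
      nlinarith
    exact le_of_excess_defect_lt hmono hB hM hb hlo hΛ hθ hτ hθτ hLip hexc hbdd hDdef hp hpγ hh hf hh' hf' j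

/-- **TWO-SIDED EXCESSES COMPARE WHEN `θ·ε_hi ≤ ε_lo`.**  Same base `B` (isotone, zeroth moment, floor, level-Lipschitz age profile `Λ` with moment `θ`); `B′` ANY functional
whose excess has NO sign structure but two-sided bounds on the box, `ε_lo ≤ B′ u − B u ≤ ε_hi` with `ε_lo > 0`.  If **`θ·ε_hi ≤ ε_lo`** then every box solution `h′` of
`B′ ≤ β̄` lies below the box solution `h` of `B` from the same pin, at every scale — the excess has defect `τ = ε_hi∕ε_lo − 1` and `(1+τ)θ = θ·ε_hi∕ε_lo ≤ 1`
(`le_of_excess_defect`).  (An excess that may VANISH somewhere, `ε_lo = 0`, is (E49b): comparison fails for every `θ > 0`.) [folklore] -/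
theorem le_of_two_sided_excess {Λ : ℕ → ℝ} {K : ℕ} {βb p εlo εhi : ℝ}
    (hmono : ∀ u v : ℕ → ℝ, SeqBox γ u → SeqBox γ v → (∀ i, u i ≤ v i) → B u ≤ B v)
    (hB : ∀ u u' : ℕ → ℝ, SeqBox γ u → SeqBox γ u' → ∀ D : ℝ, (∀ j, |u j - u' j| ≤ D) → |B u - B u'| ≤ M * D) (hM : 0 ≤ M)
    (hb : 0 < b) (hlo : ∀ u, SeqBox γ u → b ≤ B u)
    (hΛ : ∀ k, 0 ≤ Λ k) (hεlo : 0 < εlo) (hθε : (∑ k ∈ range K, (k : ℝ) * Λ k) * εhi ≤ εlo)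
    (hLip : ∀ u v : ℕ → ℝ, SeqBox γ u → SeqBox γ v → (∀ k : ℕ, 1 / γ ^ 2 + ((k : ℝ) + 1) * b ≤ 1 / u k ^ 2) →
      (∀ k : ℕ, 1 / γ ^ 2 + ((k : ℝ) + 1) * b ≤ 1 / v k ^ 2) → B u - B v ≤ ∑ k ∈ range K, Λ k * max (1 / v k ^ 2 - 1 / u k ^ 2) 0)
    (htwo : ∀ u, SeqBox γ u → εlo ≤ B' u - B u ∧ B' u - B u ≤ εhi) (hbdd : ∀ u, SeqBox γ u → B' u ≤ βb)
    (hp : 0 < p) (hpγ : p ≤ γ) (hh : SeqBox γ h) (hf : MemFlow B p h) (hh' : SeqBox γ h') (hf' : MemFlow B' p h') (j : ℕ) :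
    h' j ≤ h j := by
  -- the box is inhabited by the constant configuration at the pin, so ε_lo ≤ ε_hi
  have hcst : SeqBox γ (fun _ => p) := fun _ => ⟨hp, hpγ⟩
  have hlohi : εlo ≤ εhi := (htwo _ hcst).1.trans (htwo _ hcst).2
  have hεhi : 0 < εhi := hεlo.trans_le hlohi
  set τ : ℝ := εhi / εlo - 1 with hτdef
  have h1τ : 1 + τ = εhi / εlo := by rw [hτdef]; ring
  have hτ : 0 ≤ τ := by
    rw [hτdef, sub_nonneg, le_div_iff₀ hεlo, one_mul]
    exact hlohi
  have hθ0 : 0 ≤ ∑ k ∈ range K, (k : ℝ) * Λ k := sum_nonneg fun k _ => mul_nonneg (Nat.cast_nonneg k) (hΛ k)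
  have hθτ : (1 + τ) * ∑ k ∈ range K, (k : ℝ) * Λ k ≤ 1 := by
    rw [h1τ, div_mul_eq_mul_div, div_le_one hεlo, mul_comm]
    exact hθε
  have hexc : ∀ u, SeqBox γ u → B u ≤ B' u := fun u hu => by linarith [(htwo u hu).1]
  have hDdef : ∀ u v : ℕ → ℝ, SeqBox γ u → SeqBox γ v → (∀ i, u i ≤ v i) → B' u - B u ≤ (1 + τ) * (B' v - B v) := by
    intro u v hu hv _
    have hu2 := (htwo u hu).2
    have hv1 := (htwo v hv).1
    rw [h1τ]
    calc B' u - B u ≤ εhi := hu2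
      _ = εhi / εlo * εlo := by field_simp
      _ ≤ εhi / εlo * (B' v - B v) := mul_le_mul_of_nonneg_left hv1 (div_nonneg hεhi.le hεlo.le)
  exact le_of_excess_defect hmono hB hM hb hlo hΛ hτ hθτ hLip hexc hbdd hDdef hp hpγ hh hf hh' hf' j

end Summit.QuantumFields.BalabanUV.Beta.EriceRemainderEnclosureHistoryAutonomyComparisonDefect

end
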